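import Summits.ValiantsHypothesis.ValiantsHypothesis.Theorems.MonotoneRestorationOrbitRestorationQPValueSymSupport
import HarnessLib

/-!
# Rigid operand multisets: in a small-width wide derivation every product step is EXACTLY permuted by a pointwise
# stabiliser (ORBIT currency, XX)

Route MonotoneRestoration, crux `OrbitRestorationQP` (stmt-ValiantsHypothesis-18293), namespace
`Summit.ValiantsHypothesis.ValiantsHypothesis.Theorems.ValueSymSupport` (continued).  Route-independent (no `Theses` import).

The wide form of the crux (`ValueOrbit.orbitRestorationQP_iff_wideOrbitQP`): sums are free, a product costs the orbit of its
operand MULTISET.  The support theorem for values (`ValueSymSupport.exists_symSupport`, file `…ValueSymSupport.lean`) says that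
in a computation all of whose values have `< C(n,k)` translates every VALUE is fixed by the full pointwise stabiliser of `< k`
indices.  THIS FILE adds the same for the OPERAND MULTISETS of the product steps of a wide derivation of orbit width `< C(n,k)`:
each such multiset `M` is permuted EXACTLY — as a multiset of polynomials, not up to units — by every permutation fixing
pointwise some `X_M` with `|X_M| < k` (`exists_symSupport_prod`).  Dixon–Mortimer applied to the stabiliser of `M` gives the even
permutations (`exists_altSupport_multiset`); a transposition `τ` outside `X_M` is upgraded by counting multiplicities: for
`u ∈ M` with support `Y_u`, `τ·u = (τ τ_u)·u` with `τ_u` a transposition outside `X_M ∪ Y_u`, and `τ τ_u` is even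
(`map_ren_eq_of_alt_of_supported`).

So the BLOCK CRITERION of `BlockProducts.qpOrbitRestorable_of_blocks` (blocks permuted exactly by the pointwise stabiliser of
`≤ k` indices ⇒ restorable) is not only sufficient but NECESSARY for every product step of a small-width computation: rigid
supports everywhere, for values and for operand multisets.  Everything is proved. [folklore]

## References
* A. Dawar, G. Wilsenach, *Symmetric arithmetic circuits*, ToC 21 (2025), Def. 6.1, Thm 6.3. [DawarWilsenach2025]
* J. D. Dixon, B. Mortimer, *Permutation Groups*, GTM 163 (1996), Thm 5.2B. [DixonMortimer1996]
-/

noncomputable section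

open scoped Classical

-- `Summit.ValiantsHypothesis.ValiantsHypothesis.…` is the tree's single-conjunct layout (Sub = Summit).
set_option linter.dupNamespace false

namespace Summit.ValiantsHypothesis.ValiantsHypothesis.Theorems

namespace ValueSymSupport

open Equiv Literature.GroupTheory.PermutationGroups

variable {n : ℕ}

/-! ### Renaming multisets -/

/-- Renaming a multiset by a product. [folklore] -/
theorem multiset_map_ren_mul (σ τ : Perm (Fin n)) (M : Multiset (MvPolynomial (Fin n × Fin n) ℂ)) :
    M.map (ren (σ * τ)) = (M.map (ren τ)).map (ren σ) := by
  rw [Multiset.map_map]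
  exact Multiset.map_congr rfl fun u _ => ren_mul σ τ u

/-- Renaming a multiset by `1`. [folklore] -/
theorem multiset_map_ren_one (M : Multiset (MvPolynomial (Fin n × Fin n) ℂ)) :
    M.map (ren (1 : Perm (Fin n))) = M := by
  conv_rhs => rw [← Multiset.map_id M]
  exact Multiset.map_congr rfl fun u _ => ren_one u

/-! ### Orbit ⇒ alternating support, for multisets -/

/-- **Small orbit ⇒ small alternating support, for a multiset of values** (Dixon–Mortimer 5.2B applied to the stabiliser of
the multiset; cf. `ValueSupport.exists_altSupport_of_ncard_lt_choose` for one value). [cite: DixonMortimer1996, Thm 5.2B] -/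
theorem exists_altSupport_multiset {k : ℕ} (hn : 8 < n) (hk : 1 ≤ k) (h4k : 4 * k ≤ n)
    (M : Multiset (MvPolynomial (Fin n × Fin n) ℂ))
    (hM : (Set.range fun σ : Perm (Fin n) => M.map (ren σ)).ncard < n.choose k) :
    ∃ X : Finset (Fin n), X.card < k ∧
      ∀ ρ : Perm (Fin n), (∀ x ∈ X, ρ x = x) → Perm.sign ρ = 1 → M.map (ren ρ) = M := by
  let S : Subgroup (Perm (Fin n)) :=
    { carrier := {ρ | M.map (ren ρ) = M}
      mul_mem' := by
        intro a b ha hb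
        simp only [Set.mem_setOf_eq] at ha hb ⊢
        rw [multiset_map_ren_mul, hb, ha]
      one_mem' := multiset_map_ren_one M
      inv_mem' := by
        intro a ha
        simp only [Set.mem_setOf_eq] at ha ⊢
        conv_lhs => rw [← ha]
        rw [← multiset_map_ren_mul, inv_mul_cancel, multiset_map_ren_one] }
  have hS : ∀ ρ : Perm (Fin n), ρ ∈ S ↔ M.map (ren ρ) = M := fun ρ => Iff.rfl
  have hindex : S.index ≤ (Set.range fun σ : Perm (Fin n) => M.map (ren σ)).ncard := by
    let f : Perm (Fin n) ⧸ S → Set.range (fun σ : Perm (Fin n) => M.map (ren σ)) :=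
      fun c => ⟨M.map (ren c.out), c.out, rfl⟩
    have hf : Function.Injective f := by
      intro a b hab
      have hab' : M.map (ren a.out) = M.map (ren b.out) := congrArg Subtype.val hab
      rw [← QuotientGroup.out_eq' a, ← QuotientGroup.out_eq' b, QuotientGroup.eq, hS, multiset_map_ren_mul]
      have : (M.map (ren b.out)).map (ren a.out⁻¹) = (M.map (ren a.out)).map (ren a.out⁻¹) := by rw [hab']
      rw [this, ← multiset_map_ren_mul, inv_mul_cancel, multiset_map_ren_one]
    have := Nat.card_le_card_of_injective f hf
    rwa [Nat.card_coe_set_eq] at this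
  have hidx : S.index < (Fintype.card (Fin n)).choose k := by
    rw [Fintype.card_fin]; exact hindex.trans_lt hM
  obtain ⟨X, hXk, hX⟩ := alternating_fixing_le_of_index_lt_choose S k (by rwa [Fintype.card_fin]) hk
    (by rwa [Fintype.card_fin]) hidx
  exact ⟨X, hXk, fun ρ hρ hsign => (hS ρ).1 (hX ρ hρ hsign)⟩

/-! ### Upgrading to the full pointwise stabiliser -/

/-- Multisets: if every transposition outside `X` permutes `M` exactly, so does every permutation fixing `X` pointwise.
[folklore] -/
theorem map_ren_eq_of_swap (X : Finset (Fin n)) {M : Multiset (MvPolynomial (Fin n × Fin n) ℂ)}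
    (h : ∀ a b : Fin n, a ∉ X → b ∉ X → a ≠ b → M.map (ren (swap a b)) = M) :
    ∀ ρ : Perm (Fin n), (∀ x ∈ X, ρ x = x) → M.map (ren ρ) = M := by
  suffices H : ∀ N : ℕ, ∀ ρ : Perm (Fin n), ρ.support.card ≤ N → (∀ x ∈ X, ρ x = x) → M.map (ren ρ) = M from
    fun ρ => H _ ρ le_rfl
  intro N
  induction N with
  | zero =>
    intro ρ hρ _
    have hρ1 : ρ = 1 := Perm.support_eq_empty_iff.1 (Finset.card_eq_zero.1 (Nat.le_zero.1 hρ))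
    rw [hρ1, multiset_map_ren_one]
  | succ N ih =>
    intro ρ hρ hX
    by_cases h1 : ρ = 1
    · rw [h1, multiset_map_ren_one]
    have hna : ¬ ∀ a, ρ a = a := fun hc => h1 (Equiv.ext hc)
    obtain ⟨a, ha⟩ := not_forall.1 hna
    have haX : a ∉ X := fun haX => ha (hX a haX)
    have hρaX : ρ a ∉ X := fun h' => ha (ρ.injective (hX (ρ a) h'))
    have hne : a ≠ ρ a := fun h' => ha h'.symm
    have hcard : (swap a (ρ a) * ρ).support.card < ρ.support.card := Perm.card_support_swap_mul ha
    have hρ'X : ∀ x ∈ X, (swap a (ρ a) * ρ) x = x := by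
      intro x hx
      rw [Perm.mul_apply, hX x hx, swap_apply_of_mem haX hρaX hx]
    have e1 : M.map (ren (swap a (ρ a) * ρ)) = M := ih _ (by omega) hρ'X
    have e2 : ρ = swap a (ρ a) * (swap a (ρ a) * ρ) := by rw [← mul_assoc, swap_mul_self, one_mul]
    rw [e2, multiset_map_ren_mul, e1, h a (ρ a) haX hρaX hne]

/-- **Upgrade for multisets of supported values.**  If the even permutations fixing `X` pointwise permute `M` exactly and
every member of `M` is fixed by all permutations fixing some `Y_u` pointwise, with two indices to spare outside `X ∪ Y_u`, then
every permutation fixing `X` pointwise permutes `M` exactly (count multiplicities: `τ·u = (τ τ_u)·u`). [folklore] -/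
theorem map_ren_eq_of_alt_of_supported {X : Finset (Fin n)} {M : Multiset (MvPolynomial (Fin n × Fin n) ℂ)}
    (hX : ∀ ρ : Perm (Fin n), (∀ x ∈ X, ρ x = x) → Perm.sign ρ = 1 → M.map (ren ρ) = M)
    (hM : ∀ u ∈ M, ∃ Y : Finset (Fin n), (X ∪ Y).card + 2 ≤ n ∧
      ∀ ρ : Perm (Fin n), (∀ y ∈ Y, ρ y = y) → ren ρ u = u) :
    ∀ ρ : Perm (Fin n), (∀ x ∈ X, ρ x = x) → M.map (ren ρ) = M := by
  refine map_ren_eq_of_swap X fun a b ha hb hab => ?_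
  -- every member is moved by `swap a b` as by an even permutation fixing `X`
  have hmem : ∀ u ∈ M, ∃ g : Perm (Fin n), (∀ x ∈ X, g x = x) ∧ Perm.sign g = 1 ∧ ren (swap a b) u = ren g u := by
    intro u hu
    obtain ⟨Y, hroom, hY⟩ := hM u hu
    obtain ⟨c, d, hc, hd, hcd⟩ := exists_pair_not_mem (X ∪ Y) hroom
    simp only [Finset.mem_union, not_or] at hc hd
    refine ⟨swap a b * swap c d, fun x hx => ?_, ?_, ?_⟩
    · rw [Perm.mul_apply, swap_apply_of_mem hc.1 hd.1 hx, swap_apply_of_mem ha hb hx]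
    · rw [Perm.sign_mul, Perm.sign_swap hab, Perm.sign_swap hcd]; decide
    · rw [ren_mul, hY _ fun y hy => swap_apply_of_mem hc.2 hd.2 hy]
  -- counting multiplicities
  have hcount_even : ∀ (g : Perm (Fin n)), (∀ x ∈ X, g x = x) → Perm.sign g = 1 →
      ∀ r, M.count (ren g r) = M.count r := by
    intro g hg hs r
    conv_lhs => rw [← hX g hg hs]
    exact Multiset.count_map_eq_count' _ _ (ren_injective g) r
  have hinv : ∀ r : MvPolynomial (Fin n × Fin n) ℂ, ren (swap a b) (ren (swap a b) r) = r := fun r => by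
    rw [← ren_mul, swap_mul_self, ren_one]
  have hkey : ∀ r, M.count (ren (swap a b) r) = M.count r := by
    intro r
    by_cases hr : r ∈ M
    · obtain ⟨g, hg, hs, hgr⟩ := hmem r hr
      rw [hgr, hcount_even g hg hs]
    · by_cases hr' : ren (swap a b) r ∈ M
      · obtain ⟨g, hg, hs, hgr⟩ := hmem _ hr'
        rw [hinv] at hgr
        conv_rhs => rw [hgr]
        rw [hcount_even g hg hs]
      · rw [Multiset.count_eq_zero.2 hr, Multiset.count_eq_zero.2 hr']
  ext r
  rw [← hkey r, ← Multiset.count_map_eq_count' _ M (ren_injective (swap a b)) (ren (swap a b) r), hinv]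

/-- **RIGID OPERAND MULTISETS.**  In a wide derivation of orbit width `B < C(n,k)` (`n > 8`, `3 ≤ k ≤ n/4`), the operand multiset
of every product step of width `≤ B` is permuted EXACTLY by every permutation fixing pointwise some set of fewer than `k`
indices. [folklore; cite: DawarWilsenach2025, Def. 6.1] -/
theorem exists_symSupport_prod {k B : ℕ} (hn : 8 < n) (hk : 3 ≤ k) (h4k : 4 * k ≤ n)
    (𝒲 : WideDerivation ℂ (Fin n × Fin n)) (hW : 𝒲.OrbitWidthLE (Perm (Fin n)) B) (hB : B < n.choose k)
    (M : Multiset (MvPolynomial (Fin n × Fin n) ℂ)) (hMS : ∀ u ∈ M, u ∈ 𝒲.S)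
    (hM : (Set.range fun σ : Perm (Fin n) => M.map (ren σ)).ncard ≤ B) :
    ∃ X : Finset (Fin n), X.card < k ∧ ∀ ρ : Perm (Fin n), (∀ x ∈ X, ρ x = x) → M.map (ren ρ) = M := by
  obtain ⟨X, hXk, hX⟩ := exists_altSupport_multiset hn (by omega) h4k M (hM.trans_lt hB)
  refine ⟨X, hXk, map_ren_eq_of_alt_of_supported hX fun u hu => ?_⟩
  obtain ⟨Y, hYk, hY⟩ := exists_symSupport_of_wide hn hk h4k 𝒲 hW hB u (hMS u hu)
  refine ⟨Y, ?_, hY⟩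
  have := Finset.card_union_le X Y
  omega

/-- **Rigid supports everywhere** (values AND operand multisets): for every value `q` of a wide derivation of orbit width
`B < C(n,k)`, `q` is fixed by the pointwise stabiliser of `< k` indices, and if its chosen step is a product `Π M` then `M` is
permuted exactly by the pointwise stabiliser of `< k` indices — the hypotheses of the block criterion
`BlockProducts.qpOrbitRestorable_of_blocks` are necessary. [folklore] -/
theorem rigid_everywhere {k B : ℕ} (hn : 8 < n) (hk : 3 ≤ k) (h4k : 4 * k ≤ n)
    (𝒲 : WideDerivation ℂ (Fin n × Fin n)) (hW : 𝒲.OrbitWidthLE (Perm (Fin n)) B) (hB : B < n.choose k) :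
    ∀ q ∈ 𝒲.S, (∃ X : Finset (Fin n), X.card < k ∧ ∀ ρ : Perm (Fin n), (∀ x ∈ X, ρ x = x) → ren ρ q = q) ∧
      ∃ d : WStep ℂ (Fin n × Fin n), d.Valid 𝒲.S 𝒲.rank q ∧
        ∀ M, d = WStep.prod M →
          ∃ X : Finset (Fin n), X.card < k ∧ ∀ ρ : Perm (Fin n), (∀ x ∈ X, ρ x = x) → M.map (ren ρ) = M := by
  intro q hq
  refine ⟨exists_symSupport_of_wide hn hk h4k 𝒲 hW hB q hq, ?_⟩
  obtain ⟨-, d, hd, hdM⟩ := hW q hq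
  refine ⟨d, hd, fun M hM => ?_⟩
  refine exists_symSupport_prod hn hk h4k 𝒲 hW hB M (fun u hu => ?_) (hdM M hM)
  have := hd.args_lt u (by rw [hM]; exact hu)
  exact this.1

/-! ### Alternating-but-not-symmetric polynomials are never values -/

/-- **Alternating-but-not-symmetric polynomials are never values.**  If every EVEN permutation fixes `q` but some permutation
moves it (e.g. the diagonal Vandermonde, or `D·g` with `g` invariant), then `q` is not a value of any value derivation all of
whose values have fewer than `C(n,k)` translates (`n > 8`, `3 ≤ k ≤ n/4`): a support of `< k` indices leaves a transposition
outside it, which together with the even permutations generates everything. [folklore] -/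
theorem not_mem_of_altInvariant {k : ℕ} (hn : 8 < n) (hk : 3 ≤ k) (h4k : 4 * k ≤ n)
    (𝒟 : ValueDerivation ℂ (Fin n × Fin n))
    (hS : ∀ q ∈ 𝒟.S, (Set.range fun σ : Perm (Fin n) => ren σ q).ncard < n.choose k)
    {q : MvPolynomial (Fin n × Fin n) ℂ} (halt : ∀ ρ : Perm (Fin n), Perm.sign ρ = 1 → ren ρ q = q)
    {σ : Perm (Fin n)} (hσ : ren σ q ≠ q) : q ∉ 𝒟.S := by
  intro hmem
  obtain ⟨X, hXk, hX⟩ := exists_symSupport hn hk h4k 𝒟 hS q hmem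
  obtain ⟨a, b, ha, hb, hab⟩ := exists_pair_not_mem X (by omega)
  have hτ : ren (swap a b) q = q := hX _ fun x hx => swap_apply_of_mem ha hb hx
  rcases Int.units_eq_one_or (Perm.sign σ) with hs | hs
  · exact hσ (halt σ hs)
  · have heven : Perm.sign (σ * swap a b) = 1 := by
      rw [Perm.sign_mul, hs, Perm.sign_swap hab]; decide
    apply hσ
    calc ren σ q = ren (σ * swap a b * swap a b) q := by rw [mul_assoc, swap_mul_self, mul_one]
      _ = q := by rw [ren_mul, hτ, halt _ heven]

end ValueSymSupport

end Summit.ValiantsHypothesis.ValiantsHypothesis.Theorems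

end
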